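import Summits.QuantumFields.YangMills.Theorems.UnitScaleTiltProp7TwistedChartLocallyOnto
import Summits.QuantumFields.YangMills.Theorems.UnitScaleTiltProp7ChartRealityTwS
import Summits.QuantumFields.YangMills.Theorems.UnitScaleTiltProp7SymFrameBound
import Summits.QuantumFields.YangMills.Theorems.UnitScaleTiltProp7SymAvgGLSmallOfRegPr
import Summits.QuantumFields.YangMills.Theorems.UnitScaleTiltProp7CritEL
import Literature.MathematicalPhysics.QuantumFieldTheory.Balaban1983to89.T3PrintedRegularOrbits
import HarnessLib

/-!
# Route `UnitScaleTilt`, crux K1 child «MinimiserStabilityRegPr» (stmt-QuantumFields-19200), skeleton v10, stub `stub_existenceMinimalOrbit` (EX), route (α),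
# DENSITY line (★★OWNER RULING g28-№8 (B)) — **(D4b) THE DESCENT `D_{n,K}` IS LOCALLY ONTO AT EVERY PRINTED-REGULAR CONFIGURATION: for `U₀ ∈ 𝔘_k(ρ)`,
# `ρ ≤ aR := 1∕(13·10¹⁴L³)`, every neighbourhood of `U₀` meets the fibre `𝔅_k(V′)` of every datum `V′` close enough to `V = D_{n,K}U₀`** — the hypothesis `hLS` of
# ✓p674041 `Prop7ExistenceByDensityLimit.existenceMinimalOrbit_of_macroSector_dense_localSurj` (and of ✓-candidate `Prop7StubEXOfDensity`), VERBATIM.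

Cell `ym3-torus`, width seat `ym3-torus-px10` (gen 3).  THEOREMS ONLY (0 `def`, 0 `sorry`).  `--supports stmt-QuantumFields-19200 --as helper`,
count-neutral.  YM₃ on T³ is a ladder rung (R3), not the Clay problem; nothing here claims the stub, the crux, d = 4 or the mass gap.

HOW.  Given `V′` near `V`, put `w(c) := log(V′(c)·V(c)⁻¹)` (`𝔰𝔲(2)`-valued and small); ✓`Prop7TwistedChartLocallyOnto.exists_logChartTwS_eq_of_nhds` gives a small
`𝔰𝔲(2)`-valued `A = iX` with `log U̿^{twS}(A) = w`; un-logging (✓`MatrixLog.exp_mlog`, window ✓`norm_dbarTwS_sub_one_le`) and unfolding `U̿^{twS}` (✓`dbarTwS_def`) with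
`D̄(U₀♭) = V♭` (✓`descendToGL_eq_of_mem_fibre_of_regPr`) and the agreement `D̄((e^{iX}U₀)♭) = (D_{n,K}(e^{iX}U₀))♭` (✓`unitsField_toUField_descendTo_of_regPr`,
✓`unitsField_toUField_emb15_expHermField`; `e^{iX}U₀` is printed-regular because `𝔘_k(ρ)` is OPEN, ✓`isOpen_regPr`) gives `D_{n,K}(e^{iX}U₀) = V′^{g}` with `g` the
`SU(2)`-valued symmetric frames (✓`frameTwS_mem_specialUnitaryUnits_of_regPr`); regauging by the lift of `g⁻¹` (✓`liftTransfTo`, ✓`descendTo_gaugeAct`,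
✓`descTransf_liftTransfTo`) lands in `𝔅_k(V′)`; the regauged field depends continuously on `A` at `A = 0` (frames differentiable at `0`, ✓`hasFDerivAt_frameTwS_of_regPr`,
`= 1` there), so it lies in the prescribed neighbourhood of `U₀`.

WHAT IS PROVED (sorry-free, no definition; ns `…Theorems.Prop7DescentLocallyOntoOfRegPr`):
* §1 `val_inv_of_mem_su`, `descendTo_emb15_eq_gaugeAct_of_logChartTwS` — the algebra: `log U̿^{twS}(iX) = log(V′·V⁻¹)` ⇒ `D_{n,K}(e^{iX}U₀) = V′^{g}`.
* §2 `eventually_mem_of_values` — neighbourhoods of an `SU(2)` field read through continuously varying matrix values (product topology of record).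
* §3 ★★ `descendTo_locallyOnto_of_regPr` (member: `RegPr F n K ε₀ U₀`, `13·10¹⁴L³ε₀ ≤ 1`, `n < K`): `∀ N ∈ 𝓝 U₀, ∀ᶠ V′ in 𝓝 (D_{n,K}U₀), ∃ U″ ∈ N, U″ ∈ 𝔅_k(V′)`.
* §4 ★★★ `localSurj_T3 (L) (hL : 1 < L)` — the hypothesis `hLS` of ✓p674041 §3 VERBATIM (`aR := 1∕(13·10¹⁴·L³)`).

HONEST SCOPE.  Bookkeeping over the tree's chart letters and the inverse function theorem of the sibling; nothing of [Balaban1985Variational] is asserted; no stub ∕ crux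
statement is advanced; YM₃ on T³ = rung R3 — not d = 4, not infinite volume, not a mass gap, not Clay.

References: T. Bałaban, CMP 98 (1985) 17–51 [Balaban1985Averaging] ((11)–(13) p.19, (89)–(92) p.31, (97) p.32); CMP 99 (1985) 389–434 [Balaban1985BackgroundPropagators]
((3.13)–(3.15) p.393); CMP 102 (1985) 277–309 [Balaban1985Variational] ((3)–(6) p.278, (15) p.280, (44)–(51) pp.285–286).
-/

set_option autoImplicit false

noncomputable section

open Metric Set Filter Topology NormedSpace
open scoped Matrix.Norms.L2Operator

namespace Summit.QuantumFields.YangMills.Theorems.Prop7DescentLocallyOntoOfRegPr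

open Literature.MathematicalPhysics.QuantumFieldTheory.Balaban1983to89
open Literature.MathematicalPhysics.QuantumFieldTheory.Balaban1983to89.T3ContinuumYM3Torus
open T3PrintedRegularMinimiser (RegPr)
open T3PrintedRegularOrbits (descTransf liftTransfTo descendTo_gaugeAct descTransf_liftTransfTo)
open T3ConstrainedMinimiser (fibre)
open T3TiltDescent (descendTo)
open T3UnitLawGaugeInvariance (blockUp)
open T3LevelShift (siteShift)
open T3SectALandauChart (eta eta_pos pos_of_regPr bgUnits emb15)
open B7Prop1Explicit (expUnit val_expUnit)
open B7Prop2SpecialUnitary (specialUnitaryUnits mem_specialUnitaryUnits)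
open B10Eq27TorusAxialLog (unitsField toUField val_unitsField)
open MatrixLog (mlog exp_mlog mlog_one)
open Summit.QuantumFields.YangMills.Theorems.Prop7TPrint (expHermField)
open Summit.QuantumFields.YangMills.Theorems.Prop7CritEL (isOpen_regPr)
open Summit.QuantumFields.YangMills.Theorems.Prop7SymAvgGL (descendToGL)
open Summit.QuantumFields.YangMills.Theorems.Prop7SymAvgGLSmallOfRegPr (bgUnits_eq descendToGL_eq_of_mem_fibre_of_regPr unitsField_toUField_descendTo_of_regPr)
open Summit.QuantumFields.YangMills.Theorems.Prop7SymAvgTwSym (frameTwS dbarTwS logChartTwS dbarTwS_def logChartTwS_apply frameTwS_zero)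
open Summit.QuantumFields.YangMills.Theorems.Prop7Chart48SymUntwisted (unitsField_toUField_emb15_expHermField)
open Summit.QuantumFields.YangMills.Theorems.Prop7DbarTwSymWindow (norm_dbarTwS_sub_one_le)
open Summit.QuantumFields.YangMills.Theorems.Prop7SymFrameBound (frameTwS_mem_specialUnitaryUnits_of_regPr hasFDerivAt_frameTwS_of_regPr)
open Summit.QuantumFields.YangMills.Theorems.Prop7ChartRealityTwS (star_mlog_eq_neg_and_trace_zero_of_su2)
open Summit.QuantumFields.YangMills.Theorems.Prop7TwistedChartLocallyOnto (exists_logChartTwS_eq_of_nhds)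

variable (F : T3Family) {n K : ℕ} (h : n ≤ K)

/-! ## §1 From the chart identity to the fibre identity -/

/-- The value of the inverse of a special-unitary unit is the adjoint. [folklore] -/
theorem val_inv_of_mem_su {u : (Matrix (Fin 2) (Fin 2) ℂ)ˣ} (hu : u ∈ specialUnitaryUnits (Fin 2)) :
    ((u⁻¹ : (Matrix (Fin 2) (Fin 2) ℂ)ˣ) : Matrix (Fin 2) (Fin 2) ℂ) = star (u : Matrix (Fin 2) (Fin 2) ℂ) := by
  have h1 : (u : Matrix (Fin 2) (Fin 2) ℂ) * star (u : Matrix (Fin 2) (Fin 2) ℂ) = 1 :=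
    Matrix.mem_unitaryGroup_iff.mp (Matrix.mem_specialUnitaryGroup_iff.mp (mem_specialUnitaryUnits.mp hu)).1
  calc ((u⁻¹ : (Matrix (Fin 2) (Fin 2) ℂ)ˣ) : Matrix (Fin 2) (Fin 2) ℂ)
      = ((u⁻¹ : (Matrix (Fin 2) (Fin 2) ℂ)ˣ) : Matrix (Fin 2) (Fin 2) ℂ) * ((u : Matrix (Fin 2) (Fin 2) ℂ) * star (u : Matrix (Fin 2) (Fin 2) ℂ)) := by rw [h1, mul_one]
    _ = star (u : Matrix (Fin 2) (Fin 2) ℂ) := by rw [← mul_assoc, Units.inv_mul, one_mul]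

/-- **THE ALGEBRA OF THE FIBRE IDENTITY**: at a printed-regular background `U₀ ∈ 𝔅_k(V)`, for a Hermitian-traceless `X` in the window (`‖X(b)‖ ≤ e·η`, `10⁹L²e ≤ 1`,
`10¹²L³ε₀ ≤ 1`) with `e^{iX}U₀` printed-regular (`10⁷L³ε₁ ≤ 1`), a coarse datum `V′` with `‖V′(c)V(c)⁻¹ − 1‖ < 1` and the chart identity `log U̿^{twS}(iX) = log(V′V⁻¹)`,
and the frames packaged as an `SU(2)` gauge `g`: `D_{n,K}(e^{iX}U₀) = V′^{g}`. [cite: Balaban1985Averaging, (89)-(92) p.31; Balaban1985Variational, (3) p.278, (15) p.280] -/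
theorem descendTo_emb15_eq_gaugeAct_of_logChartTwS {ε₀ e ε₁ : ℝ} (hε₀ : 0 < ε₀) (he : 0 ≤ e) (hWe : 10 ^ 9 * (F.L : ℝ) ^ 2 * e ≤ 1)
    (hWε : 10 ^ 12 * (F.L : ℝ) ^ 3 * ε₀ ≤ 1) (hε₀7 : 10 ^ 7 * (F.L : ℝ) ^ 3 * ε₀ ≤ 1) (hε₁ : 0 < ε₁) (hε₁7 : 10 ^ 7 * (F.L : ℝ) ^ 3 * ε₁ ≤ 1)
    {U₀ : GaugeField (F.P K) 0 (Matrix.specialUnitaryGroup (Fin 2) ℂ)} (hreg : RegPr F n K ε₀ U₀)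
    {V : GaugeField (F.P n) 0 (Matrix.specialUnitaryGroup (Fin 2) ℂ)} (hfib : U₀ ∈ fibre F T3UnitLawDensityEML.ℰp n K h V)
    {X : PBond (F.P K) 0 → Matrix (Fin 2) (Fin 2) ℂ} (hX : ∀ b, (X b).IsHermitian ∧ (X b).trace = 0) (hXe : ∀ b, ‖X b‖ ≤ e * eta F n K)
    (hU₁ : RegPr F n K ε₁ (emb15 U₀ (expHermField X)))
    {V' : GaugeField (F.P n) 0 (Matrix.specialUnitaryGroup (Fin 2) ℂ)}
    (hV' : ∀ c, ‖((V' c : Matrix.specialUnitaryGroup (Fin 2) ℂ) : Matrix (Fin 2) (Fin 2) ℂ) * star ((V c : Matrix.specialUnitaryGroup (Fin 2) ℂ) : Matrix (Fin 2) (Fin 2) ℂ) - 1‖ < 1)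
    (hchart : logChartTwS F n K h U₀ (fun b => Complex.I • X b) =
      fun c => mlog (((V' c : Matrix.specialUnitaryGroup (Fin 2) ℂ) : Matrix (Fin 2) (Fin 2) ℂ) * star ((V c : Matrix.specialUnitaryGroup (Fin 2) ℂ) : Matrix (Fin 2) (Fin 2) ℂ)))
    (g : GaugeTransf (F.P n) 0 (Matrix.specialUnitaryGroup (Fin 2) ℂ))
    (hg : ∀ y, ((g y : Matrix.specialUnitaryGroup (Fin 2) ℂ) : Matrix (Fin 2) (Fin 2) ℂ) = ((frameTwS F n K h U₀ (fun b => Complex.I • X b) y : (Matrix (Fin 2) (Fin 2) ℂ)ˣ) : Matrix (Fin 2) (Fin 2) ℂ)) :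
    descendTo F T3UnitLawDensityEML.ℰp n K h (emb15 U₀ (expHermField X)) = GaugeField.gaugeAct g V' := by
  set A : PBond (F.P K) 0 → Matrix (Fin 2) (Fin 2) ℂ := fun b => Complex.I • X b with hA
  have hAe : ∀ b, ‖A b‖ ≤ e * eta F n K := fun b => by
    rw [hA]; simp only [norm_smul, Complex.norm_I, one_mul]; exact hXe b
  -- frames are special unitary
  have hfr : ∀ y, frameTwS F n K h U₀ A y ∈ specialUnitaryUnits (Fin 2) := fun y =>
    frameTwS_mem_specialUnitaryUnits_of_regPr F h hε₀ he hWε hWe U₀ hreg X (fun b => (hX b).1) (fun b => (hX b).2) hXe y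
  funext c
  -- the twisted average equals `V′(c)·V(c)⁻¹`
  have hwin : ‖((dbarTwS F n K h U₀ A c : (Matrix (Fin 2) (Fin 2) ℂ)ˣ) : Matrix (Fin 2) (Fin 2) ℂ) - 1‖ < 1 := by
    have h1 := (norm_dbarTwS_sub_one_le F h hε₀ he hWe hWε U₀ hreg A hAe c).1
    have hL3 : (3 : ℝ) ≤ F.L := by
      have : 3 ≤ F.L := by obtain ⟨a, ha⟩ := F.hL.1; have := F.hL.2; omega
      exact_mod_cast this
    have hL1 : (1 : ℝ) ≤ F.L := by linarith
    have he9 : 10 ^ 9 * e ≤ 1 :=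
      calc 10 ^ 9 * e = 10 ^ 9 * e * 1 * 1 := by ring
        _ ≤ 10 ^ 9 * e * (F.L : ℝ) * (F.L : ℝ) := by gcongr
        _ = 10 ^ 9 * (F.L : ℝ) ^ 2 * e := by ring
        _ ≤ 1 := hWe
    have hε12 : 10 ^ 12 * ((F.L : ℝ) * ε₀) ≤ 1 :=
      calc 10 ^ 12 * ((F.L : ℝ) * ε₀) = 10 ^ 12 * ε₀ * (F.L : ℝ) * 1 * 1 := by ring
        _ ≤ 10 ^ 12 * ε₀ * (F.L : ℝ) * (F.L : ℝ) * (F.L : ℝ) := by gcongr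
        _ = 10 ^ 12 * (F.L : ℝ) ^ 3 * ε₀ := by ring
        _ ≤ 1 := hWε
    have h2 : 3 * (2 * e + 2700 * (F.L : ℝ) * ε₀) < 1 := by nlinarith
    exact lt_of_le_of_lt h1 h2
  have hdbar : ((dbarTwS F n K h U₀ A c : (Matrix (Fin 2) (Fin 2) ℂ)ˣ) : Matrix (Fin 2) (Fin 2) ℂ) =
      ((V' c : Matrix.specialUnitaryGroup (Fin 2) ℂ) : Matrix (Fin 2) (Fin 2) ℂ) * star ((V c : Matrix.specialUnitaryGroup (Fin 2) ℂ) : Matrix (Fin 2) (Fin 2) ℂ) := by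
    have h1 := congrFun hchart c
    rw [logChartTwS_apply] at h1
    rw [← exp_mlog hwin, h1, exp_mlog (hV' c)]
  -- the two descents in `(M₂)ˣ` letters
  have hD₀ : descendToGL F n K h (bgUnits F K U₀) = unitsField (toUField V) := by
    rw [bgUnits_eq]; exact descendToGL_eq_of_mem_fibre_of_regPr F h hε₀ hε₀7 hfib hreg
  have hD₁ : descendToGL F n K h (fun b => expUnit (A b) * bgUnits F K U₀ b) =
      unitsField (toUField (descendTo F T3UnitLawDensityEML.ℰp n K h (emb15 U₀ (expHermField X)))) := by
    rw [hA, ← unitsField_toUField_emb15_expHermField F U₀ X hX, unitsField_toUField_descendTo_of_regPr F h hε₁ hε₁7 hU₁]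
  -- unfold `U̿^{twS}` and solve for `D̄(e^{iX}U₀)(c)`
  have hdef := dbarTwS_def (F := F) (n := n) (K := K) (h := h) U₀ A c
  rw [hD₀, hD₁] at hdef
  have hunits : unitsField (toUField (descendTo F T3UnitLawDensityEML.ℰp n K h (emb15 U₀ (expHermField X)))) c =
      frameTwS F n K h U₀ A c.src * dbarTwS F n K h U₀ A c * unitsField (toUField V) c * (frameTwS F n K h U₀ A c.tgt)⁻¹ := by
    rw [hdef]; group
  apply Subtype.ext
  have hval := congrArg (fun u : (Matrix (Fin 2) (Fin 2) ℂ)ˣ => (u : Matrix (Fin 2) (Fin 2) ℂ)) hunits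
  simp only [Units.val_mul, val_unitsField] at hval
  have hVV : star ((V c : Matrix.specialUnitaryGroup (Fin 2) ℂ) : Matrix (Fin 2) (Fin 2) ℂ) * ((V c : Matrix.specialUnitaryGroup (Fin 2) ℂ) : Matrix (Fin 2) (Fin 2) ℂ) = 1 :=
    Matrix.mem_unitaryGroup_iff'.mp (Matrix.mem_specialUnitaryGroup_iff.mp (V c).2).1
  -- LHS value
  have lhs : ((descendTo F T3UnitLawDensityEML.ℰp n K h (emb15 U₀ (expHermField X)) c : Matrix.specialUnitaryGroup (Fin 2) ℂ) : Matrix (Fin 2) (Fin 2) ℂ) =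
      ((frameTwS F n K h U₀ A c.src : (Matrix (Fin 2) (Fin 2) ℂ)ˣ) : Matrix (Fin 2) (Fin 2) ℂ) * ((V' c : Matrix.specialUnitaryGroup (Fin 2) ℂ) : Matrix (Fin 2) (Fin 2) ℂ) *
        star ((frameTwS F n K h U₀ A c.tgt : (Matrix (Fin 2) (Fin 2) ℂ)ˣ) : Matrix (Fin 2) (Fin 2) ℂ) := by
    have e1 : ((descendTo F T3UnitLawDensityEML.ℰp n K h (emb15 U₀ (expHermField X)) c : Matrix.specialUnitaryGroup (Fin 2) ℂ) : Matrix (Fin 2) (Fin 2) ℂ) =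
        ((toUField (descendTo F T3UnitLawDensityEML.ℰp n K h (emb15 U₀ (expHermField X))) c : Matrix.unitaryGroup (Fin 2) ℂ) : Matrix (Fin 2) (Fin 2) ℂ) := rfl
    rw [e1, hval, hdbar, val_inv_of_mem_su (hfr c.tgt)]
    have e2 : ((toUField V c : Matrix.unitaryGroup (Fin 2) ℂ) : Matrix (Fin 2) (Fin 2) ℂ) = ((V c : Matrix.specialUnitaryGroup (Fin 2) ℂ) : Matrix (Fin 2) (Fin 2) ℂ) := rfl
    rw [e2]
    have e3 : ((V' c : Matrix.specialUnitaryGroup (Fin 2) ℂ) : Matrix (Fin 2) (Fin 2) ℂ) * star ((V c : Matrix.specialUnitaryGroup (Fin 2) ℂ) : Matrix (Fin 2) (Fin 2) ℂ) *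
        ((V c : Matrix.specialUnitaryGroup (Fin 2) ℂ) : Matrix (Fin 2) (Fin 2) ℂ) = ((V' c : Matrix.specialUnitaryGroup (Fin 2) ℂ) : Matrix (Fin 2) (Fin 2) ℂ) := by
      rw [mul_assoc, hVV, mul_one]
    rw [mul_assoc (((frameTwS F n K h U₀ A c.src : (Matrix (Fin 2) (Fin 2) ℂ)ˣ) : Matrix (Fin 2) (Fin 2) ℂ))
      (((V' c : Matrix.specialUnitaryGroup (Fin 2) ℂ) : Matrix (Fin 2) (Fin 2) ℂ) * star ((V c : Matrix.specialUnitaryGroup (Fin 2) ℂ) : Matrix (Fin 2) (Fin 2) ℂ)), e3]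
  -- RHS value
  have rhs : ((GaugeField.gaugeAct g V' c : Matrix.specialUnitaryGroup (Fin 2) ℂ) : Matrix (Fin 2) (Fin 2) ℂ) =
      ((frameTwS F n K h U₀ A c.src : (Matrix (Fin 2) (Fin 2) ℂ)ˣ) : Matrix (Fin 2) (Fin 2) ℂ) * ((V' c : Matrix.specialUnitaryGroup (Fin 2) ℂ) : Matrix (Fin 2) (Fin 2) ℂ) *
        star ((frameTwS F n K h U₀ A c.tgt : (Matrix (Fin 2) (Fin 2) ℂ)ˣ) : Matrix (Fin 2) (Fin 2) ℂ) := by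
    show (((g c.src * V' c * (g c.tgt)⁻¹ : Matrix.specialUnitaryGroup (Fin 2) ℂ)) : Matrix (Fin 2) (Fin 2) ℂ) = _
    rw [Submonoid.coe_mul, Submonoid.coe_mul, Literature.MathematicalPhysics.QuantumLattice.coe_inv_eq_star, hg c.src, hg c.tgt]
  exact lhs.trans rhs.symm

/-! ## §2 A patching lemma: neighbourhoods of an `SU(2)` field through matrix values -/

open Classical in
/-- **NEIGHBOURHOODS THROUGH MATRIX VALUES**: if matrix-valued bond functions `M(A)` depend continuously on a parameter `A` at `A₀`, with `M(A₀) = U₀♭`, then for `A` near `A₀`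
every `SU(2)` field whose values are `M(A)` lies in a prescribed neighbourhood of `U₀` (product topology of record). [folklore] -/
theorem eventually_mem_of_values {E : Type*} [TopologicalSpace E] {P : Params} {j : ℕ} (M : E → PBond P j → Matrix (Fin 2) (Fin 2) ℂ) (A₀ : E)
    (U₀ : GaugeField P j (Matrix.specialUnitaryGroup (Fin 2) ℂ)) (hM : ∀ b, ContinuousAt (fun A => M A b) A₀)
    (hM0 : ∀ b, M A₀ b = ((U₀ b : Matrix.specialUnitaryGroup (Fin 2) ℂ) : Matrix (Fin 2) (Fin 2) ℂ))
    {N : Set (GaugeField P j (Matrix.specialUnitaryGroup (Fin 2) ℂ))} (hN : N ∈ 𝓝 U₀) :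
    ∀ᶠ A in 𝓝 A₀, ∀ U : GaugeField P j (Matrix.specialUnitaryGroup (Fin 2) ℂ),
      (∀ b, ((U b : Matrix.specialUnitaryGroup (Fin 2) ℂ) : Matrix (Fin 2) (Fin 2) ℂ) = M A b) → U ∈ N := by
  -- the patched field
  let Φ : E → GaugeField P j (Matrix.specialUnitaryGroup (Fin 2) ℂ) := fun A b =>
    if hb : M A b ∈ Matrix.specialUnitaryGroup (Fin 2) ℂ then ⟨M A b, hb⟩ else U₀ b
  have hΦval : ∀ A b, ‖((Φ A b : Matrix.specialUnitaryGroup (Fin 2) ℂ) : Matrix (Fin 2) (Fin 2) ℂ) - ((U₀ b : Matrix.specialUnitaryGroup (Fin 2) ℂ) : Matrix (Fin 2) (Fin 2) ℂ)‖ ≤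
      ‖M A b - ((U₀ b : Matrix.specialUnitaryGroup (Fin 2) ℂ) : Matrix (Fin 2) (Fin 2) ℂ)‖ := by
    intro A b
    by_cases hb : M A b ∈ Matrix.specialUnitaryGroup (Fin 2) ℂ
    · have : ((Φ A b : Matrix.specialUnitaryGroup (Fin 2) ℂ) : Matrix (Fin 2) (Fin 2) ℂ) = M A b := by
        show (((if hb : M A b ∈ Matrix.specialUnitaryGroup (Fin 2) ℂ then (⟨M A b, hb⟩ : Matrix.specialUnitaryGroup (Fin 2) ℂ) else U₀ b) :
          Matrix.specialUnitaryGroup (Fin 2) ℂ) : Matrix (Fin 2) (Fin 2) ℂ) = M A b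
        rw [dif_pos hb]
      rw [this]
    · have : Φ A b = U₀ b := by
        show (if hb : M A b ∈ Matrix.specialUnitaryGroup (Fin 2) ℂ then (⟨M A b, hb⟩ : Matrix.specialUnitaryGroup (Fin 2) ℂ) else U₀ b) = U₀ b
        rw [dif_neg hb]
      rw [this, sub_self, norm_zero]; exact norm_nonneg _
  have hΦ0 : ∀ b, Φ A₀ b = U₀ b := fun b => by
    have hb : M A₀ b ∈ Matrix.specialUnitaryGroup (Fin 2) ℂ := by rw [hM0 b]; exact (U₀ b).2
    apply Subtype.ext
    show (((if hb : M A₀ b ∈ Matrix.specialUnitaryGroup (Fin 2) ℂ then (⟨M A₀ b, hb⟩ : Matrix.specialUnitaryGroup (Fin 2) ℂ) else U₀ b) :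
      Matrix.specialUnitaryGroup (Fin 2) ℂ) : Matrix (Fin 2) (Fin 2) ℂ) = ((U₀ b : Matrix.specialUnitaryGroup (Fin 2) ℂ) : Matrix (Fin 2) (Fin 2) ℂ)
    rw [dif_pos hb]
    exact hM0 b
  have hΦb : ∀ b, ContinuousAt (fun A => ((Φ A b : Matrix.specialUnitaryGroup (Fin 2) ℂ) : Matrix (Fin 2) (Fin 2) ℂ)) A₀ := fun b => by
    have hg : Tendsto (fun A => ‖M A b - ((U₀ b : Matrix.specialUnitaryGroup (Fin 2) ℂ) : Matrix (Fin 2) (Fin 2) ℂ)‖) (𝓝 A₀) (𝓝 0) := by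
      have h1 := tendsto_iff_norm_sub_tendsto_zero.1 (hM b)
      simpa only [hM0 b] using h1
    have h3 : Tendsto (fun A => ((Φ A b : Matrix.specialUnitaryGroup (Fin 2) ℂ) : Matrix (Fin 2) (Fin 2) ℂ)) (𝓝 A₀)
        (𝓝 ((U₀ b : Matrix.specialUnitaryGroup (Fin 2) ℂ) : Matrix (Fin 2) (Fin 2) ℂ)) :=
      tendsto_iff_norm_sub_tendsto_zero.2 (squeeze_zero (fun A => norm_nonneg _) (fun A => hΦval A b) hg)
    show Tendsto (fun A => ((Φ A b : Matrix.specialUnitaryGroup (Fin 2) ℂ) : Matrix (Fin 2) (Fin 2) ℂ)) (𝓝 A₀)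
      (𝓝 ((Φ A₀ b : Matrix.specialUnitaryGroup (Fin 2) ℂ) : Matrix (Fin 2) (Fin 2) ℂ))
    rw [hΦ0 b]; exact h3
  have hΦcont : ContinuousAt Φ A₀ := continuousAt_pi.2 fun b => (Topology.IsInducing.subtypeVal.continuousAt_iff).2 (hΦb b)
  have hΦA₀ : Φ A₀ = U₀ := funext hΦ0
  have hpre : Φ ⁻¹' N ∈ 𝓝 A₀ := hΦcont.preimage_mem_nhds (by rw [hΦA₀]; exact hN)
  refine Filter.mem_of_superset hpre fun A hA U hU => ?_
  have hUΦ : U = Φ A := funext fun b => by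
    have hb : M A b ∈ Matrix.specialUnitaryGroup (Fin 2) ℂ := by rw [← hU b]; exact (U b).2
    apply Subtype.ext
    show ((U b : Matrix.specialUnitaryGroup (Fin 2) ℂ) : Matrix (Fin 2) (Fin 2) ℂ) =
      (((if hb : M A b ∈ Matrix.specialUnitaryGroup (Fin 2) ℂ then (⟨M A b, hb⟩ : Matrix.specialUnitaryGroup (Fin 2) ℂ) else U₀ b) : Matrix.specialUnitaryGroup (Fin 2) ℂ) :
        Matrix (Fin 2) (Fin 2) ℂ)
    rw [dif_pos hb]; exact hU b
  rw [hUΦ]; exact hA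

/-! ## §3 ★★ Local surjectivity of the descent at a printed-regular configuration (member level) -/

/-- ★★ **THE DESCENT IS LOCALLY ONTO AT `U₀ ∈ 𝔘_k(ε₀)`** (`13·10¹⁴L³ε₀ ≤ 1`, `n < K`): for every neighbourhood `N` of `U₀` in `SU(2)^{bonds}`, every datum `V′` close enough to
`V = D_{n,K}U₀` has a point of `N` in its fibre `𝔅_k(V′)`. [cite: Balaban1985Averaging, (11)-(13) p.19, (89)-(92) p.31; Balaban1985Variational, (3)-(6) p.278, (44)-(51) pp.285-286] -/
theorem descendTo_locallyOnto_of_regPr (hnK : n < K) {ε₀ : ℝ} {U₀ : GaugeField (F.P K) 0 (Matrix.specialUnitaryGroup (Fin 2) ℂ)} (hreg : RegPr F n K ε₀ U₀)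
    (hwin : 13 * 10 ^ 14 * (F.L : ℝ) ^ 3 * ε₀ ≤ 1) :
    ∀ N ∈ 𝓝 U₀, ∀ᶠ V' in 𝓝 (descendTo F T3UnitLawDensityEML.ℰp n K h U₀),
      ∃ U'' ∈ N, U'' ∈ fibre F T3UnitLawDensityEML.ℰp n K h V' := by
  letI : NormedAlgebra ℚ (Matrix (Fin 2) (Fin 2) ℂ) := NormedAlgebra.restrictScalars ℚ ℂ (Matrix (Fin 2) (Fin 2) ℂ)
  -- letters and windows
  have hε₀ : 0 < ε₀ := pos_of_regPr F hreg
  have hL3n : 3 ≤ F.L := by obtain ⟨a, ha⟩ := F.hL.1; have := F.hL.2; omega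
  have hL3 : (3 : ℝ) ≤ F.L := by exact_mod_cast hL3n
  have hL0 : (0 : ℝ) < F.L := by linarith
  have hx : 0 ≤ (F.L : ℝ) ^ 3 * ε₀ := by positivity
  have hWε : 10 ^ 12 * (F.L : ℝ) ^ 3 * ε₀ ≤ 1 := by nlinarith
  have hε₀7 : 10 ^ 7 * (F.L : ℝ) ^ 3 * ε₀ ≤ 1 := by nlinarith
  set e : ℝ := 1 / (10 ^ 9 * (F.L : ℝ) ^ 2) with he_def
  have he : 0 < e := by positivity
  have hWe : 10 ^ 9 * (F.L : ℝ) ^ 2 * e ≤ 1 := by rw [he_def, mul_one_div_cancel (by positivity)]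
  have hρ : 0 < e * eta F n K := mul_pos he (eta_pos F n K)
  set V : GaugeField (F.P n) 0 (Matrix.specialUnitaryGroup (Fin 2) ℂ) := descendTo F T3UnitLawDensityEML.ℰp n K h U₀ with hV_def
  have hfib : U₀ ∈ fibre F T3UnitLawDensityEML.ℰp n K h V := rfl
  intro N hN
  -- (a) the regauged configuration as MATRIX-valued functions of `A`, continuous at `A = 0` with value `U₀♭`
  let σ : Site (F.P K) 0 → Site (F.P n) 0 := fun z => (siteShift (T3PrintedRegularOrbits.sites_eq F n K h)).symm (blockUp (K - n) z)
  let M : (PBond (F.P K) 0 → Matrix (Fin 2) (Fin 2) ℂ) → PBond (F.P K) 0 → Matrix (Fin 2) (Fin 2) ℂ := fun A b =>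
    star ((frameTwS F n K h U₀ A (σ b.src) : (Matrix (Fin 2) (Fin 2) ℂ)ˣ) : Matrix (Fin 2) (Fin 2) ℂ) *
      (exp (A b) * ((U₀ b : Matrix.specialUnitaryGroup (Fin 2) ℂ) : Matrix (Fin 2) (Fin 2) ℂ)) *
      ((frameTwS F n K h U₀ A (σ b.tgt) : (Matrix (Fin 2) (Fin 2) ℂ)ˣ) : Matrix (Fin 2) (Fin 2) ℂ)
  let M₁ : (PBond (F.P K) 0 → Matrix (Fin 2) (Fin 2) ℂ) → PBond (F.P K) 0 → Matrix (Fin 2) (Fin 2) ℂ := fun A b =>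
    exp (A b) * ((U₀ b : Matrix.specialUnitaryGroup (Fin 2) ℂ) : Matrix (Fin 2) (Fin 2) ℂ)
  have hfrc : ∀ y, ContinuousAt (fun A : PBond (F.P K) 0 → Matrix (Fin 2) (Fin 2) ℂ =>
      ((frameTwS F n K h U₀ A y : (Matrix (Fin 2) (Fin 2) ℂ)ˣ) : Matrix (Fin 2) (Fin 2) ℂ)) 0 :=
    fun y => (hasFDerivAt_frameTwS_of_regPr F h hε₀ hWε U₀ hreg y).continuousAt
  have hM₁cont : ∀ b, ContinuousAt (fun A => M₁ A b) 0 := fun b =>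
    ((exp_continuous.continuousAt).comp (continuous_apply b).continuousAt).mul continuousAt_const
  have hMcont : ∀ b, ContinuousAt (fun A => M A b) 0 := fun b =>
    (((hfrc (σ b.src)).star).mul (hM₁cont b)).mul (hfrc (σ b.tgt))
  have hM₁0 : ∀ b, M₁ 0 b = ((U₀ b : Matrix.specialUnitaryGroup (Fin 2) ℂ) : Matrix (Fin 2) (Fin 2) ℂ) := fun b => by
    simp only [M₁, Pi.zero_apply, exp_zero, one_mul]
  have hM0 : ∀ b, M 0 b = ((U₀ b : Matrix.specialUnitaryGroup (Fin 2) ℂ) : Matrix (Fin 2) (Fin 2) ℂ) := fun b => by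
    simp only [M, frameTwS_zero, Units.val_one, star_one, one_mul, mul_one, Pi.zero_apply, exp_zero]
  -- (b) the neighbourhood of record in the `A`-variable: fields with values `M A` lie in `N`, fields with values `M₁ A` are printed-regular, `‖A‖ < e·η`
  have hO : {U : GaugeField (F.P K) 0 (Matrix.specialUnitaryGroup (Fin 2) ℂ) | RegPr F n K ε₀ U} ∈ 𝓝 U₀ := (isOpen_regPr F n K ε₀).mem_nhds hreg
  have hNA : {A : PBond (F.P K) 0 → Matrix (Fin 2) (Fin 2) ℂ |
        (∀ U : GaugeField (F.P K) 0 (Matrix.specialUnitaryGroup (Fin 2) ℂ), (∀ b, ((U b : Matrix.specialUnitaryGroup (Fin 2) ℂ) : Matrix (Fin 2) (Fin 2) ℂ) = M A b) → U ∈ N) ∧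
        (∀ U : GaugeField (F.P K) 0 (Matrix.specialUnitaryGroup (Fin 2) ℂ), (∀ b, ((U b : Matrix.specialUnitaryGroup (Fin 2) ℂ) : Matrix (Fin 2) (Fin 2) ℂ) = M₁ A b) →
          U ∈ {U : GaugeField (F.P K) 0 (Matrix.specialUnitaryGroup (Fin 2) ℂ) | RegPr F n K ε₀ U}) ∧
        A ∈ ball (0 : PBond (F.P K) 0 → Matrix (Fin 2) (Fin 2) ℂ) (e * eta F n K)} ∈ 𝓝 (0 : PBond (F.P K) 0 → Matrix (Fin 2) (Fin 2) ℂ) :=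
    inter_mem (eventually_mem_of_values M 0 U₀ hMcont hM0 hN) (inter_mem (eventually_mem_of_values M₁ 0 U₀ hM₁cont hM₁0 hO) (ball_mem_nhds _ hρ))
  -- (c) the chart is locally onto: a neighbourhood `W` of `0` of targets
  obtain ⟨W, hW, hsolve⟩ := exists_logChartTwS_eq_of_nhds F h hnK hreg hwin _ hNA
  -- (d) the log-coordinate `V′ ↦ log(V′V⁻¹)` is continuous at `V` with value `0`
  let ω : GaugeField (F.P n) 0 (Matrix.specialUnitaryGroup (Fin 2) ℂ) → PBond (F.P n) 0 → Matrix (Fin 2) (Fin 2) ℂ := fun V' c =>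
    mlog (((V' c : Matrix.specialUnitaryGroup (Fin 2) ℂ) : Matrix (Fin 2) (Fin 2) ℂ) * star ((V c : Matrix.specialUnitaryGroup (Fin 2) ℂ) : Matrix (Fin 2) (Fin 2) ℂ))
  have hVV : ∀ c, ((V c : Matrix.specialUnitaryGroup (Fin 2) ℂ) : Matrix (Fin 2) (Fin 2) ℂ) * star ((V c : Matrix.specialUnitaryGroup (Fin 2) ℂ) : Matrix (Fin 2) (Fin 2) ℂ) = 1 :=
    fun c => Matrix.mem_unitaryGroup_iff.mp (Matrix.mem_specialUnitaryGroup_iff.mp (V c).2).1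
  have hratio_cont : ∀ c, ContinuousAt (fun V' : GaugeField (F.P n) 0 (Matrix.specialUnitaryGroup (Fin 2) ℂ) =>
      ((V' c : Matrix.specialUnitaryGroup (Fin 2) ℂ) : Matrix (Fin 2) (Fin 2) ℂ) * star ((V c : Matrix.specialUnitaryGroup (Fin 2) ℂ) : Matrix (Fin 2) (Fin 2) ℂ)) V :=
    fun c => ((continuous_subtype_val.comp (continuous_apply c)).continuousAt).mul continuousAt_const
  have hω_cont : ∀ c, ContinuousAt (fun V' => ω V' c) V := by
    intro c
    have h1 : ContinuousAt (mlog : Matrix (Fin 2) (Fin 2) ℂ → Matrix (Fin 2) (Fin 2) ℂ)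
        (((V c : Matrix.specialUnitaryGroup (Fin 2) ℂ) : Matrix (Fin 2) (Fin 2) ℂ) * star ((V c : Matrix.specialUnitaryGroup (Fin 2) ℂ) : Matrix (Fin 2) (Fin 2) ℂ)) := by
      rw [hVV c]
      exact (ExpMeanLog.analyticAt_mlog (by rw [sub_self, norm_zero]; norm_num)).continuousAt
    have hcomp : (fun V' => ω V' c) = (mlog : Matrix (Fin 2) (Fin 2) ℂ → Matrix (Fin 2) (Fin 2) ℂ) ∘ (fun V' : GaugeField (F.P n) 0 (Matrix.specialUnitaryGroup (Fin 2) ℂ) =>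
        ((V' c : Matrix.specialUnitaryGroup (Fin 2) ℂ) : Matrix (Fin 2) (Fin 2) ℂ) * star ((V c : Matrix.specialUnitaryGroup (Fin 2) ℂ) : Matrix (Fin 2) (Fin 2) ℂ)) := rfl
    rw [hcomp]
    exact ContinuousAt.comp h1 (hratio_cont c)
  have hω0 : ω V = 0 := by funext c; simp only [ω, hVV c, mlog_one, Pi.zero_apply]
  have hωc : ContinuousAt ω V := continuousAt_pi.2 hω_cont
  have hωV : Tendsto ω (𝓝 V) (𝓝 0) := by simpa only [ContinuousAt, hω0] using hωc
  -- (e) the good data: `ω V′ ∈ W` and every ratio within `⅓` of `1`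
  have hgood : ∀ᶠ V' in 𝓝 V, ω V' ∈ W ∧ ∀ c, ‖((V' c : Matrix.specialUnitaryGroup (Fin 2) ℂ) : Matrix (Fin 2) (Fin 2) ℂ) *
      star ((V c : Matrix.specialUnitaryGroup (Fin 2) ℂ) : Matrix (Fin 2) (Fin 2) ℂ) - 1‖ < 1 / 3 := by
    refine (hωV.eventually_mem hW).and (eventually_all.2 fun c => ?_)
    have h1 := (hratio_cont c).eventually (Metric.ball_mem_nhds _ (by norm_num : (0 : ℝ) < 1 / 3))
    refine h1.mono fun V' hV' => ?_
    have hV'' := mem_ball_iff_norm.mp hV'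
    simp only [hVV c] at hV''
    exact hV''
  refine hgood.mono fun V' hV' => ?_
  obtain ⟨hωW, h13⟩ := hV'
  -- the target is `𝔰𝔲(2)`-valued
  have hwsu : ∀ c, star (ω V' c) = -ω V' c ∧ (ω V' c).trace = 0 := fun c => by
    refine star_mlog_eq_neg_and_trace_zero_of_su2 (Submonoid.mul_mem _ (V' c).2 ?_) (h13 c).le
    rw [← Literature.MathematicalPhysics.QuantumLattice.coe_inv_eq_star (V c)]
    exact ((V c)⁻¹).2
  -- solve the chart
  obtain ⟨A, hAN, hAsu, hchart⟩ := hsolve (ω V') hωW hwsu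
  obtain ⟨hAM, hAreg, hAball⟩ := hAN
  -- `A = iX` with `X` Hermitian traceless in the window
  set X : PBond (F.P K) 0 → Matrix (Fin 2) (Fin 2) ℂ := fun b => (-Complex.I) • A b with hX_def
  have hIX : (fun b => Complex.I • X b) = A := funext fun b => by
    rw [hX_def]; simp only [smul_smul, mul_neg, Complex.I_mul_I, neg_neg, one_smul]
  have hX : ∀ b, (X b).IsHermitian ∧ (X b).trace = 0 := fun b => by
    refine ⟨?_, by rw [hX_def]; simp only [Matrix.trace_smul, (hAsu b).2, smul_zero]⟩
    show star (X b) = X b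
    rw [hX_def]
    show star ((-Complex.I) • A b) = (-Complex.I) • A b
    rw [star_smul, (hAsu b).1, star_neg, Complex.star_def, Complex.conj_I, neg_neg, smul_neg, ← neg_smul]
  have hXe : ∀ b, ‖X b‖ ≤ e * eta F n K := fun b => by
    have : ‖X b‖ = ‖A b‖ := by rw [hX_def]; simp only [norm_smul, norm_neg, Complex.norm_I, one_mul]
    rw [this]; exact (norm_le_pi_norm A b).trans (mem_ball_zero_iff.1 hAball).le
  -- `e^{iX}U₀` has values `M₁ A` and is printed-regular (openness of `𝔘_k(ε₀)`)
  have hvalU₁ : ∀ b, ((emb15 U₀ (expHermField X) b : Matrix.specialUnitaryGroup (Fin 2) ℂ) : Matrix (Fin 2) (Fin 2) ℂ) = M₁ A b := fun b => by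
    have h1 := congrArg (fun u : (Matrix (Fin 2) (Fin 2) ℂ)ˣ => (u : Matrix (Fin 2) (Fin 2) ℂ)) (congrFun (unitsField_toUField_emb15_expHermField F U₀ X hX) b)
    simp only [val_unitsField, Units.val_mul, val_expUnit] at h1
    rw [congrFun hIX b, bgUnits_eq, val_unitsField] at h1
    exact h1
  have hU₁ : RegPr F n K ε₀ (emb15 U₀ (expHermField X)) := hAreg _ hvalU₁
  -- the frames as an `SU(2)` gauge
  have hfr : ∀ y, frameTwS F n K h U₀ A y ∈ specialUnitaryUnits (Fin 2) := fun y => by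
    rw [← hIX]; exact frameTwS_mem_specialUnitaryUnits_of_regPr F h hε₀ he.le hWε hWe U₀ hreg X (fun b => (hX b).1) (fun b => (hX b).2) hXe y
  let g : GaugeTransf (F.P n) 0 (Matrix.specialUnitaryGroup (Fin 2) ℂ) := fun y =>
    ⟨((frameTwS F n K h U₀ A y : (Matrix (Fin 2) (Fin 2) ℂ)ˣ) : Matrix (Fin 2) (Fin 2) ℂ), mem_specialUnitaryUnits.mp (hfr y)⟩
  have hg : ∀ y, ((g y : Matrix.specialUnitaryGroup (Fin 2) ℂ) : Matrix (Fin 2) (Fin 2) ℂ) =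
      ((frameTwS F n K h U₀ (fun b => Complex.I • X b) y : (Matrix (Fin 2) (Fin 2) ℂ)ˣ) : Matrix (Fin 2) (Fin 2) ℂ) := fun y => by rw [hIX]
  -- the fibre identity `D_{n,K}(e^{iX}U₀) = V′^{g}`
  have hchart' : logChartTwS F n K h U₀ (fun b => Complex.I • X b) = ω V' := by rw [hIX]; exact hchart
  have hdesc := descendTo_emb15_eq_gaugeAct_of_logChartTwS F h hε₀ he.le hWe hWε hε₀7 hε₀ hε₀7 hreg hfib hX hXe hU₁
    (V' := V') (fun c => (h13 c).trans (by norm_num)) hchart' g hg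
  -- regauge by the lift of `g⁻¹`
  let u : GaugeTransf (F.P K) 0 (Matrix.specialUnitaryGroup (Fin 2) ℂ) := liftTransfTo F n K h (fun y => (g y)⁻¹)
  refine ⟨GaugeField.gaugeAct u (emb15 U₀ (expHermField X)), ?_, ?_⟩
  · -- closeness to `U₀`: the values are `M A b`
    refine hAM _ fun b => ?_
    show (((u b.src * emb15 U₀ (expHermField X) b * (u b.tgt)⁻¹ : Matrix.specialUnitaryGroup (Fin 2) ℂ)) : Matrix (Fin 2) (Fin 2) ℂ) = M A b
    have hu : ∀ z, ((u z : Matrix.specialUnitaryGroup (Fin 2) ℂ) : Matrix (Fin 2) (Fin 2) ℂ) =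
        star ((frameTwS F n K h U₀ A (σ z) : (Matrix (Fin 2) (Fin 2) ℂ)ˣ) : Matrix (Fin 2) (Fin 2) ℂ) := fun z => rfl
    rw [Submonoid.coe_mul, Submonoid.coe_mul, hvalU₁ b, Literature.MathematicalPhysics.QuantumLattice.coe_inv_eq_star, hu, hu, star_star]
  · -- the fibre: `D(U^u) = (D U)^{u↓} = (V′^{g})^{g⁻¹} = V′`
    show descendTo F T3UnitLawDensityEML.ℰp n K h (GaugeField.gaugeAct u (emb15 U₀ (expHermField X))) = V'
    rw [descendTo_gaugeAct, descTransf_liftTransfTo, hdesc]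
    funext c
    show (g c.src)⁻¹ * (g c.src * V' c * (g c.tgt)⁻¹) * ((g c.tgt)⁻¹)⁻¹ = V' c
    group

/-! ## §4 ★★★ The hypothesis `hLS` of the DENSITY knit -/

/-- ★★★ **`hLS` OF ✓p674041 `Prop7ExistenceByDensityLimit.existenceMinimalOrbit_of_macroSector_dense_localSurj` (VERBATIM)**: with `aR := 1∕(13·10¹⁴·L³)`, for every member
`F` with `F.L = L`, `n < K`, every `ρ ≤ aR` and every `U′ ∈ 𝔘_k(ρ)`, the descent is locally onto at `U′`. [cite: Balaban1985Averaging, (11) p.19; Balaban1985Variational, (3)-(6) p.278] -/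
theorem localSurj_T3 (L : ℕ) (hL : 1 < L) :
    ∃ aR : ℝ, 0 < aR ∧ ∀ (F : T3Family), F.L = L → ∀ (n K : ℕ) (hnK : n < K) (ρ : ℝ), ρ ≤ aR →
      ∀ U' : GaugeField (F.P K) 0 (Matrix.specialUnitaryGroup (Fin 2) ℂ), RegPr F n K ρ U' →
        ∀ N ∈ 𝓝 U', ∀ᶠ V' in 𝓝 (descendTo F T3UnitLawDensityEML.ℰp n K hnK.le U'), ∃ U'' ∈ N, U'' ∈ fibre F T3UnitLawDensityEML.ℰp n K hnK.le V' := by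
  have hL0 : (0 : ℝ) < (L : ℝ) := by exact_mod_cast (lt_trans zero_lt_one hL)
  refine ⟨1 / (13 * 10 ^ 14 * (L : ℝ) ^ 3), by positivity, ?_⟩
  intro F hF n K hnK ρ hρ U' hreg N hN
  have hwin : 13 * 10 ^ 14 * (F.L : ℝ) ^ 3 * ρ ≤ 1 := by
    have hF' : (F.L : ℝ) = L := by exact_mod_cast hF
    rw [hF']
    have hK : (0 : ℝ) < 13 * 10 ^ 14 * (L : ℝ) ^ 3 := by positivity
    have := (le_div_iff₀ hK).1 hρ
    linarith
  exact descendTo_locallyOnto_of_regPr F hnK.le hnK hreg hwin N hN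

end Summit.QuantumFields.YangMills.Theorems.Prop7DescentLocallyOntoOfRegPr

end
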